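import Literature.Analysis.FluidPDE.ChenHouContinuationProofs
import Literature.Analysis.FluidPDE.AxisymmetricVorticityTransport
import HarnessLib

/-!
# Smooth Euler flows in the periodic cylinder: the uniqueness clause of Kato–Lai's Thm I
(`KatoLai1984_periodicCylinderUniqueness`) and the propagation of axisymmetry

Topic `Literature/Analysis/FluidPDE`. Support file below the maximal-solution argument
`Ferrari1993_periodicCylinderEulerBKM_of_localExistence_of_continuation`
(`ChenHouContinuationProofs.lean`), whose local-existence hypothesis asks that smooth
**axisymmetric** axially periodic divergence-free data, tangential on the wall of the cylinder
`{r < 1}`, launch for a short time a classical solution of the incompressible Euler equations of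
the class `IsCylinderEulerSolution` (smooth up to the boundary jointly in `(t, x)`, axisymmetric,
`L`-periodic velocity and pressure).

The source (T. Kato, C. Y. Lai, *Nonlinear evolution equations and the Euler flow*, J. Funct.
Anal. 56 (1984) 15–28) prints, for a bounded domain `Ω ⊂ ℝ^m` with smooth boundary:

* **Thm I** (p. 17; proof §5 pp. 20–23 from the abstract Thm A of §3): for `s ≥ s₀ = [m/2] + 2`,
  `φ ∈ H^s_σ`, `f ∈ C([0,T₀]; H^s_σ)` there are `T > 0` and a **unique** solution
  `u ∈ C([0,T]; H^s_σ)` of `∂ₜu + P(u·∇)u = f`, `u(0) = φ`, with `T` depending only on the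
  `H^{s₀}` size of the data; uniqueness is the `L²` energy identity
  `d/dt ‖u − v‖₀² = 2(u − v | ∂ₜ(u − v))₀` (p. 23);
* **Thm II** (p. 17; proof §6): the solution is as regular as the data, in particular
  `u(t) ∈ C^∞(Ω̄)` for `C^∞` data.

Neither theorem mentions symmetry: the axisymmetry of the solution issuing from axisymmetric
data comes from the uniqueness clause of Thm I. This file makes that step a **theorem**. It
vendors

* `KatoLai1984_periodicCylinderUniqueness` — the uniqueness clause of Thm I in the class
  `IsPeriodicCylinderEulerSolution` (= `IsCylinderEulerSolution` minus the axisymmetry clause):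
  two solutions on `[0, T)` with the same data have the same velocity on `[0, T) × closure Ω`
  (**discharged** downstream: `KatoLai1984_periodicCylinderUniqueness_holds`,
  `KatoLaiPeriodicCylinderProofs.lean`, the `L²` energy method on a period cell),

and **proves**

* `IsPeriodicCylinderEulerSolution.isCylinderEulerSolution_extendByData`: under uniqueness, a
  solution of the periodic class on `[0, T)` with axisymmetric `L`-periodic datum becomes, once its
  velocity is redefined as the datum outside the closed cylinder (which changes nothing the class
  sees), a solution of the axisymmetric class `IsCylinderEulerSolution`;
* `KatoLai1984_periodicCylinderLocalExistence_of_existence_of_uniqueness : existence without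
  symmetry → uniqueness → existence in the axisymmetric class`, with both local-existence
  statements written out. The existence input is Kato–Lai's Thm I/II in the periodic cylinder,
  carried in the tree by the single named fact `KatoLai1984_periodicCylinderUniformExistence`
  (`Ferrari1993Continuation.lean`, Thm I with its printed uniformity clause), from which
  `KatoLaiUniformExistenceBridge.lean` derives the hypothesis used here and hence the conclusion
  (`KatoLai1984_periodicCylinderLocalExistence_of_uniformExistence`); the earlier renderings
  `KatoLai1984_periodicCylinderSmoothExistence` and `KatoLai1984_periodicCylinderLocalExistence` of
  the same printed theorem are retired as named facts (one printed theorem, one named fact;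
  D-0026),

by the folklore argument: the Euler equations in the cylinder, the slip condition and axial
periodicity are covariant under the rotations `R_θ` about the axis
(`IsPeriodicCylinderEulerSolution.conj_rotZ`, from the pointwise covariance of
`IsometryInvariance` and `e_r(R_θ x) = R_θ e_r(x)`), so `(R_θ u R_θ⁻¹, p ∘ R_θ⁻¹)` is a solution
with datum `R_θ u₀ R_θ⁻¹ = u₀`; uniqueness gives `u(t, R_θ x) = R_θ u(t, x)` on the closed
cylinder; redefining `u(t, ·)` as `u₀` outside the closed cylinder (which changes nothing the
class sees: `isPeriodicCylinderEulerSolution_extendByData`) makes every time slice globally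
axisymmetric and keeps it `L`-periodic.

## Faithfulness / what is NOT here

* Uniqueness is stated in the class `IsPeriodicCylinderEulerSolution`, for the periodic cylinder,
  with the adaptation caveat of `Ferrari1993_periodicCylinderEulerBKM` (printed for bounded smooth
  domains of `ℝ³`; the periodic cylinder `{r ≤ 1} × ℝ/Lℤ` is a compact flat manifold with
  boundary — the use made in print by Luo–Hou 2014 §4.4 and Chen–Hou 2021 §9; Ebin–Marsden 1970
  treat compact manifolds with boundary, not held). The `C^∞` class embeds in Kato–Lai's
  `C([0,T']; H^s_σ)` for every `T' < T` and every `s`; the pressure is not asserted unique (it is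
  determined up to a function of time only). Periodicity of the **pressure** is essential for
  uniqueness (axial Galilean boosts `u(t, x − a(t)e_z) + a'(t)e_z`, `p − a''(t)z` are solutions
  with the same data and non-periodic pressure), hence `0 < L` is kept.
* Not here: the discharge of uniqueness (downstream, `KatoLaiPeriodicCylinderProofs.lean`:
  integration by parts on a period cell against fields tangential on `{r = 1}` and periodic in
  `z`, Gronwall) and the existence theory itself (`KatoLai1984_periodicCylinderUniformExistence`:
  Sobolev spaces up to a curved boundary, the Leray projection on `H^s(Ω)`, elliptic Neumann
  regularity, Kato–Lai's Thm A — absent from Mathlib).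

Mathlib/tree search: `lean search 'IsCylinderEulerSolution|periodicCylinder'` — only
`ChenHouContinuationProofs`; rotation covariance for whole-space solutions is
`IsClassicalNSSolutionOn.conj_linearIsometryEquiv` (`IsometryInvariance`), the rotation as a
linear isometry is `rotZLIE` (`AxisymmetricVorticityTransport`), propagation of axisymmetry in
the whole space is `IsClassicalNSSolutionOn.isAxisymmetric_of_data_holds`. Used from Mathlib:
`closure_lt_subset_le`, `Set.piecewise`, `Filter.EventuallyEq.fderiv_eq`,
`HasDerivWithinAt.derivWithin`, `LinearIsometryEquiv.inner_map_map`.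
-/

noncomputable section

open MeasureTheory Set Function Filter Topology TopologicalSpace WithLp
open scoped ContDiff NNReal ENNReal InnerProductSpace RealInnerProductSpace

namespace Literature.Analysis.FluidPDE

/-- Local notation for physical space `ℝ³ = EuclideanSpace ℝ (Fin 3)`. -/
local notation "ℝ³" => EuclideanSpace ℝ (Fin 3)

/-! ### Geometry of the closed cylinder: rotations and axial translations -/

/-- The closed unit cylinder is `{r ≤ 1}`: `closure {r < 1} = {r ≤ 1}` (continuity of `r`, and
`{r = 1} = frontier {r < 1}`, `frontier_unitCylinder`). [folklore] -/
theorem closure_unitCylinder : closure (unitCylinder : Set ℝ³) = {x | cylRadius x ≤ 1} := by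
  refine Subset.antisymm (closure_lt_subset_le continuous_cylRadius continuous_const) ?_
  intro x hx
  rcases (show cylRadius x ≤ 1 from hx).lt_or_eq with h | h
  · exact subset_closure (show x ∈ (unitCylinder : Set ℝ³) from h)
  · have hfr : x ∈ frontier (unitCylinder : Set ℝ³) := by
      rw [frontier_unitCylinder]
      exact h
    exact frontier_subset_closure hfr

/-- The closed cylinder is invariant under the rotations about the axis. [folklore] -/
theorem rotZ_mem_closure_unitCylinder_iff (θ : ℝ) {x : ℝ³} :
    rotZ θ x ∈ closure (unitCylinder : Set ℝ³) ↔ x ∈ closure (unitCylinder : Set ℝ³) := by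
  simp only [closure_unitCylinder, mem_setOf_eq, cylRadius_rotZ]

/-- The wall `{r = 1}` is invariant under the rotations about the axis. [folklore] -/
theorem rotZ_mem_frontier_unitCylinder_iff (θ : ℝ) {x : ℝ³} :
    rotZ θ x ∈ frontier (unitCylinder : Set ℝ³) ↔ x ∈ frontier (unitCylinder : Set ℝ³) := by
  simp only [frontier_unitCylinder, mem_setOf_eq, cylRadius_rotZ]

/-- The radial unit vector field is equivariant under the rotations about the axis:
`e_r(R_θ x) = R_θ e_r(x)` (and `0 = R_θ 0` on the axis). [folklore] -/
theorem eR_rotZ (θ : ℝ) (x : ℝ³) : eR (rotZ θ x) = rotZ θ (eR x) := by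
  ext i
  fin_cases i <;> simp [eR, cylRadius_rotZ] <;> ring

/-- The axial translation vector `L e_z`. [folklore] -/
theorem axialShift_apply (L : ℝ) (i : Fin 3) :
    (L • EuclideanSpace.single (2 : Fin 3) (1 : ℝ)) i = if i = 2 then L else 0 := by
  fin_cases i <;> simp

/-- The cylindrical radius is invariant under axial translations. [folklore] -/
theorem cylRadius_add_axialShift (L : ℝ) (x : ℝ³) :
    cylRadius (x + L • EuclideanSpace.single (2 : Fin 3) (1 : ℝ)) = cylRadius x := by
  simp [cylRadius]

/-- The closed cylinder is invariant under axial translations. [folklore] -/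
theorem add_axialShift_mem_closure_unitCylinder_iff (L : ℝ) {x : ℝ³} :
    x + L • EuclideanSpace.single (2 : Fin 3) (1 : ℝ) ∈ closure (unitCylinder : Set ℝ³) ↔
      x ∈ closure (unitCylinder : Set ℝ³) := by
  simp only [closure_unitCylinder, mem_setOf_eq, cylRadius_add_axialShift]

/-- Rotations about the axis commute with axial translations (they fix `e_z` and are linear). [folklore] -/
theorem rotZ_add_axialShift (θ L : ℝ) (x : ℝ³) :
    rotZ θ (x + L • EuclideanSpace.single (2 : Fin 3) (1 : ℝ)) =
      rotZ θ x + L • EuclideanSpace.single (2 : Fin 3) (1 : ℝ) := by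
  ext i
  fin_cases i <;> simp

/-- An axially periodic field composed with a rotation about the axis is axially periodic. [folklore] -/
theorem IsAxiallyPeriodic.comp_rotZ {F : Sort*} {L : ℝ} {v : ℝ³ → F} (hv : IsAxiallyPeriodic L v)
    (θ : ℝ) : IsAxiallyPeriodic L (fun x => v (rotZ θ x)) := fun x => by
  simp only [rotZ_add_axialShift, hv (rotZ θ x)]

/-! ### The solution class without symmetry -/

/-- **Smooth axially periodic classical Euler solutions in the periodic cylinder** — the class
`IsCylinderEulerSolution` of the target fact with the axisymmetry clause removed: `(u, p)` is a
classical solution of the incompressible Euler equations (`f = 0`) in `{r < 1}` with the slip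
condition on `{r = 1}` on the time set `S`, `u(0) = u₀`, `u` and `p` are `C^∞` on
`S × closure {r < 1}` jointly in `(t, x)`, and every time slice of the velocity and of the
pressure is `L`-periodic in `z` (the setting of Kato–Lai 1984 Thm I/II transported to the
periodic cylinder `{r ≤ 1} × ℝ/Lℤ` of Luo–Hou 2014 §4.4 and Chen–Hou). [folklore] -/
structure IsPeriodicCylinderEulerSolution (L : ℝ) (S : Set ℝ) (u₀ : ℝ³ → ℝ³) (u : ℝ → ℝ³ → ℝ³)
    (p : ℝ → ℝ³ → ℝ) : Prop where
  /-- The Euler equations in `{r < 1}` with the slip condition, on the time set `S`. -/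
  euler : IsClassicalEulerOnDomain S unitCylinder eR 0 u p
  /-- The initial datum. -/
  initial : u 0 = u₀
  /-- The velocity is `C^∞` up to the boundary, jointly in `(t, x)`. -/
  smooth_velocity : ContDiffOn ℝ ∞ (uncurry u) (S ×ˢ closure (unitCylinder : Set ℝ³))
  /-- The pressure is `C^∞` up to the boundary, jointly in `(t, x)`. -/
  smooth_pressure : ContDiffOn ℝ ∞ (uncurry p) (S ×ˢ closure (unitCylinder : Set ℝ³))
  /-- `L`-periodic velocity and pressure. -/
  periodic : ∀ t ∈ S, IsAxiallyPeriodic L (u t) ∧ IsAxiallyPeriodic L (p t)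

/-- A solution of the symmetric class is a solution of the periodic class (forget axisymmetry). [folklore] -/
theorem IsCylinderEulerSolution.isPeriodicCylinderEulerSolution {L : ℝ} {S : Set ℝ} {u₀ : ℝ³ → ℝ³}
    {u : ℝ → ℝ³ → ℝ³} {p : ℝ → ℝ³ → ℝ} (h : IsCylinderEulerSolution L S u₀ u p) :
    IsPeriodicCylinderEulerSolution L S u₀ u p :=
  ⟨h.euler, h.initial, h.smooth_velocity, h.smooth_pressure, fun t ht => (h.symmetric t ht).2⟩

/-- A solution of the periodic class with axisymmetric velocity slices is a solution of the
symmetric class. [folklore] -/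
theorem IsPeriodicCylinderEulerSolution.isCylinderEulerSolution {L : ℝ} {S : Set ℝ} {u₀ : ℝ³ → ℝ³}
    {u : ℝ → ℝ³ → ℝ³} {p : ℝ → ℝ³ → ℝ} (h : IsPeriodicCylinderEulerSolution L S u₀ u p)
    (hax : ∀ t ∈ S, IsAxisymmetric (u t)) : IsCylinderEulerSolution L S u₀ u p :=
  ⟨h.euler, h.initial, h.smooth_velocity, h.smooth_pressure, fun t ht => ⟨hax t ht, h.periodic t ht⟩⟩

/-- The class only depends on the datum through the equation `u 0 = u₀`. [folklore] -/
theorem IsPeriodicCylinderEulerSolution.congr_data {L : ℝ} {S : Set ℝ} {u₀ u₀' : ℝ³ → ℝ³}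
    {u : ℝ → ℝ³ → ℝ³} {p : ℝ → ℝ³ → ℝ} (h : IsPeriodicCylinderEulerSolution L S u₀ u p)
    (e : u₀ = u₀') : IsPeriodicCylinderEulerSolution L S u₀' u p :=
  e ▸ h

/-! ### The named fact: uniqueness -/

/-- **Uniqueness of smooth Euler flows in the periodic cylinder** (the uniqueness clause of
Kato–Lai 1984, Thm I, p. 17 — "a unique solution `u ∈ C(I_T; H^s_σ)`" — proved on p. 23 by the
`L²` energy identity `dₜ‖u − v‖₀² = 2(u − v | dₜ(u − v))₀`; quoted with the pressure as Ferrari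
1993, Thm 1, p. 279: "unique functions `u ∈ C([0,T*]; H^s(Ω))` and `p ∈ C([0,T*]; H^{s+1}(Ω))`
satisfying (1)–(3)"). **Rendering** (in the class `IsPeriodicCylinderEulerSolution`, which
embeds in `C([0,T']; H^s_σ)` of the period cell for every `T' < T`): two solutions of the class
`IsPeriodicCylinderEulerSolution L [0, T) u₀` — same datum, `L`-periodic velocities **and
pressures**, `L > 0` — have the same velocity on `[0, T) × closure {r < 1}`. The pressures are
not asserted to agree (the class determines `p(t, ·)` up to an additive function of time), and
the velocities are not asserted to agree outside the closed cylinder (the class does not see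
those values). Periodicity of the pressure cannot be dropped: the axial Galilean boosts
`u(t, x − a(t)e_z) + a'(t)e_z`, `p(t, x − a(t)e_z) − a''(t)z` with `a(0) = a'(0) = 0` solve the
same problem with the same datum. Adaptation caveat as in `Ferrari1993_periodicCylinderEulerBKM`:
the printed theorems are for bounded smooth domains of `ℝ³`, the periodic cylinder
`{r ≤ 1} × ℝ/Lℤ` is a compact flat manifold with boundary (the use made of them by Luo–Hou 2014
§4.4 and Chen–Hou, CMP 2021 §9). [cite: KatoLai1984, Thm I (p. 17, uniqueness clause; proof p. 23)]
[cite: Ferrari1993, Thm 1 (p. 279)] -/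
def KatoLai1984_periodicCylinderUniqueness : Prop :=
  ∀ (L : ℝ) (_hL : 0 < L) (T : ℝ) (u₀ : ℝ³ → ℝ³) (u₁ u₂ : ℝ → ℝ³ → ℝ³) (p₁ p₂ : ℝ → ℝ³ → ℝ)
    (_h₁ : IsPeriodicCylinderEulerSolution L (Ico 0 T) u₀ u₁ p₁)
    (_h₂ : IsPeriodicCylinderEulerSolution L (Ico 0 T) u₀ u₂ p₂),
    ∀ t ∈ Ico 0 T, ∀ x ∈ closure (unitCylinder : Set ℝ³), u₁ t x = u₂ t x

/-- Uniqueness in the symmetric class `IsCylinderEulerSolution` (forget axisymmetry). [folklore] -/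
theorem KatoLai1984_periodicCylinderUniqueness.cylinderEulerSolution
    (hU : KatoLai1984_periodicCylinderUniqueness) {L : ℝ} (hL : 0 < L) {T : ℝ} {u₀ : ℝ³ → ℝ³}
    {u₁ u₂ : ℝ → ℝ³ → ℝ³} {p₁ p₂ : ℝ → ℝ³ → ℝ} (h₁ : IsCylinderEulerSolution L (Ico 0 T) u₀ u₁ p₁)
    (h₂ : IsCylinderEulerSolution L (Ico 0 T) u₀ u₂ p₂) {t : ℝ} (ht : t ∈ Ico 0 T) {x : ℝ³}
    (hx : x ∈ closure (unitCylinder : Set ℝ³)) : u₁ t x = u₂ t x :=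
  hU L hL T u₀ u₁ u₂ p₁ p₂ h₁.isPeriodicCylinderEulerSolution h₂.isPeriodicCylinderEulerSolution
    t ht x hx

/-! ### Rotation covariance of the class -/

section Rotation

variable {L : ℝ} {S : Set ℝ} {u₀ : ℝ³ → ℝ³} {u : ℝ → ℝ³ → ℝ³} {p : ℝ → ℝ³ → ℝ}

/-- Joint smoothness on `S × closure {r < 1}` is preserved by composition with a rotation about
the axis in the space variable (the closed cylinder is rotation invariant). [folklore] -/
theorem contDiffOn_uncurry_comp_rotZ {F : Type*} [NormedAddCommGroup F] [NormedSpace ℝ F]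
    {w : ℝ → ℝ³ → F} {n : WithTop ℕ∞}
    (h : ContDiffOn ℝ n (uncurry w) (S ×ˢ closure (unitCylinder : Set ℝ³))) (θ : ℝ) :
    ContDiffOn ℝ n (uncurry fun t x => w t (rotZ θ x)) (S ×ˢ closure (unitCylinder : Set ℝ³)) := by
  have h1 : (uncurry fun t x => w t (rotZ θ x)) =
      uncurry w ∘ fun z : ℝ × ℝ³ => (z.1, rotZLIE θ z.2) := by
    funext z; rfl
  rw [h1]
  refine h.comp ((contDiff_fst.prodMk
    ((rotZLIE θ).toContinuousLinearEquiv.contDiff.comp contDiff_snd)).contDiffOn) ?_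
  rintro ⟨t, x⟩ ⟨ht, hx⟩
  exact ⟨ht, (rotZ_mem_closure_unitCylinder_iff θ).2 hx⟩

/-- The one-sided time derivative of the rotated velocity `R_θ u(t, R_{−θ} x)` at a point whose
preimage lies in the closed cylinder is `R_θ ∂ₜu(t, R_{−θ} x)` (chain rule with the linear map
`R_θ`; differentiability in time from joint `C¹` smoothness up to the boundary). [folklore] -/
theorem timeDerivWithin_rotZ_conj (h : ContDiffOn ℝ 1 (uncurry u) (S ×ˢ closure (unitCylinder : Set ℝ³)))
    (hS : UniqueDiffOn ℝ S) (θ : ℝ) {t : ℝ} (ht : t ∈ S) {x : ℝ³}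
    (hx : rotZ (-θ) x ∈ closure (unitCylinder : Set ℝ³)) :
    timeDerivWithin S (fun s y => rotZ θ (u s (rotZ (-θ) y))) t x =
      rotZ θ (timeDerivWithin S u t (rotZ (-θ) x)) := by
  simp only [timeDerivWithin_apply]
  have hd : HasDerivWithinAt (fun s => u s (rotZ (-θ) x))
      (derivWithin (fun s => u s (rotZ (-θ) x)) S t) S t :=
    (differentiableWithinAt_time_of_contDiffOn h one_ne_zero ht hx).hasDerivWithinAt
  have := ((rotZLIE θ : ℝ³ →L[ℝ] ℝ³).hasFDerivAt.comp_hasDerivWithinAt t hd).derivWithin (hS t ht)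
  simpa [Function.comp_def] using this

/-- **Rotation covariance of classical Euler solutions in the cylinder.** If `(u, p)` solves the
Euler equations in `{r < 1}` with the slip condition on a time set `S` of unique
differentiability, so does `(R_θ u(t, R_{−θ} x), p(t, R_{−θ} x))` for every rotation `R_θ` about
the axis: the cylinder, its wall and the normal field `e_r` are `R_θ`-equivariant
(`eR_rotZ`), and each term of the equations is covariant pointwise
(`convect_conj_linearIsometryEquiv`, `gradient_comp_linearIsometryEquiv_symm`,
`divergence_conj_linearIsometryEquiv`, `timeDerivWithin_rotZ_conj`) (Majda–Bertozzi, §1.2,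
Prop. 1.1 (iii), rotation symmetry, there for the whole space). [folklore] -/
theorem IsClassicalEulerOnDomain.conj_rotZ_unitCylinder
    (h : IsClassicalEulerOnDomain S unitCylinder eR 0 u p) (hS : UniqueDiffOn ℝ S) (θ : ℝ) :
    IsClassicalEulerOnDomain S unitCylinder eR 0 (fun t x => rotZ θ (u t (rotZ (-θ) x)))
      (fun t x => p t (rotZ (-θ) x)) := by
  set R := rotZLIE θ with hRdef
  have hR : ∀ y, R y = rotZ θ y := fun _ => rfl
  have hRs : ∀ y, R.symm y = rotZ (-θ) y := fun _ => rfl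
  have hsu : ContDiffOn ℝ 1 (uncurry fun t x => rotZ θ (u t (rotZ (-θ) x)))
      (S ×ˢ closure (unitCylinder : Set ℝ³)) := by
    have h1 : (uncurry fun t x => rotZ θ (u t (rotZ (-θ) x))) =
        R.toContinuousLinearEquiv ∘ uncurry fun t x => u t (rotZ (-θ) x) := by
      funext z; rfl
    rw [h1]
    exact R.toContinuousLinearEquiv.contDiff.comp_contDiffOn (contDiffOn_uncurry_comp_rotZ h.smooth.1 (-θ))
  refine ⟨⟨hsu, contDiffOn_uncurry_comp_rotZ h.smooth.2 (-θ)⟩, fun t ht x hx => ?_,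
    fun t ht x hx => ?_, fun t ht x hx => ?_⟩
  · -- momentum
    have hx' : rotZ (-θ) x ∈ unitCylinder := (rotZ_mem_unitCylinder_iff (-θ)).2 hx
    have hm := h.momentum t ht (rotZ (-θ) x) hx'
    have hc := convect_conj_linearIsometryEquiv R (u t) (u t) x
    have hg := gradient_comp_linearIsometryEquiv_symm R (p t) x
    simp only [hR, hRs, Pi.zero_apply, add_zero] at hc hg hm ⊢
    rw [timeDerivWithin_rotZ_conj h.smooth.1 hS θ ht (subset_closure hx'), hc, hg]
    show R (timeDerivWithin S u t (rotZ (-θ) x)) + R (convect (u t) (u t) (rotZ (-θ) x)) =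
      -R (gradient (p t) (rotZ (-θ) x))
    rw [← map_add, hm, map_neg]
  · -- incompressibility
    have hx' : rotZ (-θ) x ∈ unitCylinder := (rotZ_mem_unitCylinder_iff (-θ)).2 hx
    have hd := divergence_conj_linearIsometryEquiv R (u t) x
    simp only [hR, hRs] at hd
    rw [hd]
    exact h.divFree t ht _ hx'
  · -- slip
    have hx' : rotZ (-θ) x ∈ frontier (unitCylinder : Set ℝ³) :=
      (rotZ_mem_frontier_unitCylinder_iff (-θ)).2 hx
    have he : eR x = rotZ θ (eR (rotZ (-θ) x)) := by
      rw [← eR_rotZ, ← rotZ_add, add_neg_cancel, rotZ_zero]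
    rw [he, ← hR, ← hR, R.inner_map_map]
    exact h.slip t ht _ hx'

/-- **Rotation covariance of the periodic class.** If `(u, p)` is a solution of the class with
datum `u₀` on a time set of unique differentiability, then `(R_θ u(t, R_{−θ} x), p(t, R_{−θ} x))`
is a solution of the class with datum `R_θ u₀(R_{−θ} x)` (rotations about the axis commute with
the axial translations, `rotZ_add_axialShift`). [folklore] -/
theorem IsPeriodicCylinderEulerSolution.conj_rotZ (h : IsPeriodicCylinderEulerSolution L S u₀ u p)
    (hS : UniqueDiffOn ℝ S) (θ : ℝ) :
    IsPeriodicCylinderEulerSolution L S (fun x => rotZ θ (u₀ (rotZ (-θ) x)))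
      (fun t x => rotZ θ (u t (rotZ (-θ) x))) (fun t x => p t (rotZ (-θ) x)) where
  euler := h.euler.conj_rotZ_unitCylinder hS θ
  initial := by
    funext x
    simp [h.initial]
  smooth_velocity := by
    have h1 : (uncurry fun t x => rotZ θ (u t (rotZ (-θ) x))) =
        (rotZLIE θ).toContinuousLinearEquiv ∘ uncurry fun t x => u t (rotZ (-θ) x) := by
      funext z; rfl
    rw [h1]
    exact (rotZLIE θ).toContinuousLinearEquiv.contDiff.comp_contDiffOn
      (contDiffOn_uncurry_comp_rotZ h.smooth_velocity (-θ))
  smooth_pressure := contDiffOn_uncurry_comp_rotZ h.smooth_pressure (-θ)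
  periodic t ht :=
    ⟨fun x => by simp only [rotZ_add_axialShift, (h.periodic t ht).1 (rotZ (-θ) x)],
      (h.periodic t ht).2.comp_rotZ (-θ)⟩

/-- **Axisymmetry on the closed cylinder from uniqueness.** Under the uniqueness fact, a solution
of the periodic class on `[0, T)` with axisymmetric datum has rotation-equivariant velocity on
the closed cylinder: `u(t, R_θ x) = R_θ u(t, x)` for `t ∈ [0, T)`, `r(x) ≤ 1` (the rotated
solution has the same datum, `IsAxisymmetric.rotZ_apply_rotZ_neg`, so the two velocities agree on
`[0, T) × closure {r < 1}`). [folklore] -/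
theorem IsPeriodicCylinderEulerSolution.rotZ_velocity_eq (hU : KatoLai1984_periodicCylinderUniqueness)
    (hL : 0 < L) {T : ℝ} (h : IsPeriodicCylinderEulerSolution L (Ico 0 T) u₀ u p)
    (hax : IsAxisymmetric u₀) (θ : ℝ) {t : ℝ} (ht : t ∈ Ico 0 T) {x : ℝ³}
    (hx : x ∈ closure (unitCylinder : Set ℝ³)) : u t (rotZ θ x) = rotZ θ (u t x) := by
  have hrot := (h.conj_rotZ (uniqueDiffOn_Ico 0 T) θ).congr_data
    (funext fun y => hax.rotZ_apply_rotZ_neg θ y)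
  have key := hU L hL T u₀ _ u _ p hrot h t ht (rotZ θ x)
    ((rotZ_mem_closure_unitCylinder_iff θ).2 hx)
  rw [← rotZ_add, neg_add_cancel, rotZ_zero] at key
  exact key.symm

end Rotation

/-! ### Redefining the velocity outside the closed cylinder -/

section Extend

variable {L : ℝ} {S : Set ℝ} {u₀ : ℝ³ → ℝ³} {u : ℝ → ℝ³ → ℝ³} {p : ℝ → ℝ³ → ℝ}

open Classical in
/-- The velocity `u` with its values outside the closed cylinder replaced by those of the datum
`u₀`: `u(t, x)` for `r(x) ≤ 1`, `u₀(x)` for `r(x) > 1`. The class `IsPeriodicCylinderEulerSolution`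
only sees `[0, T) × closure {r < 1}` (and the datum equation), so this changes nothing it
asserts, while making global symmetries of `u₀` and of `u|_{closure}` global symmetries of every
time slice. [folklore] -/
def extendByData (u₀ : ℝ³ → ℝ³) (u : ℝ → ℝ³ → ℝ³) (t : ℝ) : ℝ³ → ℝ³ :=
  (closure (unitCylinder : Set ℝ³)).piecewise (u t) u₀

/-- Inside the closed cylinder the extension is `u`. [folklore] -/
theorem extendByData_of_mem (u₀ : ℝ³ → ℝ³) (u : ℝ → ℝ³ → ℝ³) (t : ℝ) {x : ℝ³}
    (hx : x ∈ closure (unitCylinder : Set ℝ³)) : extendByData u₀ u t x = u t x := by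
  classical
  exact Set.piecewise_eq_of_mem _ _ _ hx

/-- Outside the closed cylinder the extension is `u₀`. [folklore] -/
theorem extendByData_of_not_mem (u₀ : ℝ³ → ℝ³) (u : ℝ → ℝ³ → ℝ³) (t : ℝ) {x : ℝ³}
    (hx : x ∉ closure (unitCylinder : Set ℝ³)) : extendByData u₀ u t x = u₀ x := by
  classical
  exact Set.piecewise_eq_of_notMem _ _ _ hx

/-- Near an interior point of the cylinder the extension agrees with `u` eventually. [folklore] -/
theorem extendByData_eventuallyEq (u₀ : ℝ³ → ℝ³) (u : ℝ → ℝ³ → ℝ³) (t : ℝ) {x : ℝ³}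
    (hx : x ∈ unitCylinder) : extendByData u₀ u t =ᶠ[𝓝 x] u t :=
  Filter.eventuallyEq_of_mem (unitCylinder.isOpen.mem_nhds hx) fun _ hy =>
    extendByData_of_mem u₀ u t (subset_closure hy)

/-- **The extension is again a solution of the periodic class** (with periodic datum): all
clauses of the class concern `S × closure {r < 1}`, where nothing changed — joint smoothness by
`ContDiffOn.congr`, the spatial derivatives at interior points by `Filter.EventuallyEq.fderiv_eq`,
the time derivative because the time line at a point of the closed cylinder is unchanged — and
periodicity holds separately inside (from `u`) and outside (from `u₀`) the closed cylinder, which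
is invariant under axial translations. [folklore] -/
theorem isPeriodicCylinderEulerSolution_extendByData
    (h : IsPeriodicCylinderEulerSolution L S u₀ u p) (hper : IsAxiallyPeriodic L u₀) :
    IsPeriodicCylinderEulerSolution L S u₀ (extendByData u₀ u) p := by
  set K : Set ℝ³ := closure (unitCylinder : Set ℝ³) with hK
  have hcongr : ∀ z ∈ S ×ˢ K, uncurry (extendByData u₀ u) z = uncurry u z := fun z hz =>
    extendByData_of_mem u₀ u z.1 hz.2
  have hline : ∀ {x : ℝ³}, x ∈ K → (fun s => extendByData u₀ u s x) = fun s => u s x :=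
    fun hx => funext fun s => extendByData_of_mem u₀ u s hx
  refine ⟨⟨⟨h.euler.smooth.1.congr hcongr, h.euler.smooth.2⟩, fun t ht x hx => ?_,
    fun t ht x hx => ?_, fun t ht x hx => ?_⟩, ?_, h.smooth_velocity.congr hcongr,
    h.smooth_pressure, fun t ht => ⟨fun x => ?_, (h.periodic t ht).2⟩⟩
  · -- momentum
    have hev := extendByData_eventuallyEq u₀ u t hx
    rw [timeDerivWithin_apply, hline (subset_closure hx), ← timeDerivWithin_apply, convect_apply,
      hev.fderiv_eq, extendByData_of_mem u₀ u t (subset_closure hx), ← convect_apply]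
    exact h.euler.momentum t ht x hx
  · -- incompressibility
    have hev := extendByData_eventuallyEq u₀ u t hx
    unfold VectorCalculus.divergence
    rw [hev.fderiv_eq]
    exact h.euler.divFree t ht x hx
  · -- slip
    rw [extendByData_of_mem u₀ u t (frontier_subset_closure hx)]
    exact h.euler.slip t ht x hx
  · -- datum
    funext x
    by_cases hx : x ∈ K
    · rw [extendByData_of_mem u₀ u 0 hx, h.initial]
    · exact extendByData_of_not_mem u₀ u 0 hx
  · -- periodicity of the velocity
    by_cases hx : x ∈ K
    · rw [extendByData_of_mem u₀ u t hx,
        extendByData_of_mem u₀ u t ((add_axialShift_mem_closure_unitCylinder_iff L).2 hx)]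
      exact (h.periodic t ht).1 x
    · rw [extendByData_of_not_mem u₀ u t hx, extendByData_of_not_mem u₀ u t
        (fun h' => hx ((add_axialShift_mem_closure_unitCylinder_iff L).1 h'))]
      exact hper x

/-- **Global axisymmetry of the extended slices**: if `u₀` is axisymmetric and `u(t, ·)` is
rotation-equivariant on the closed cylinder, the extended slice is axisymmetric on all of `ℝ³`
(the closed cylinder and its complement are rotation invariant). [folklore] -/
theorem isAxisymmetric_extendByData (hax : IsAxisymmetric u₀) {t : ℝ}
    (hrot : ∀ θ : ℝ, ∀ x ∈ closure (unitCylinder : Set ℝ³), u t (rotZ θ x) = rotZ θ (u t x)) :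
    IsAxisymmetric (extendByData u₀ u t) := fun θ x => by
  by_cases hx : x ∈ closure (unitCylinder : Set ℝ³)
  · rw [extendByData_of_mem u₀ u t hx,
      extendByData_of_mem u₀ u t ((rotZ_mem_closure_unitCylinder_iff θ).2 hx)]
    exact hrot θ x hx
  · rw [extendByData_of_not_mem u₀ u t hx, extendByData_of_not_mem u₀ u t
      (fun h' => hx ((rotZ_mem_closure_unitCylinder_iff θ).1 h'))]
    exact hax θ x

end Extend

/-! ### Local existence in the axisymmetric class from existence and uniqueness -/

/-- **Axisymmetric solutions from uniqueness.** Under the uniqueness fact, a solution `(u, p)` of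
the periodic class on `[0, T)` issuing from an axisymmetric `L`-periodic datum `u₀` (`L > 0`)
yields a solution of the axisymmetric class `IsCylinderEulerSolution` with the same pressure and
the velocity `extendByData u₀ u` (equal to `u` on the closed cylinder, to `u₀` outside): by
rotation covariance and uniqueness the velocity is rotation-equivariant on the closed cylinder
(`IsPeriodicCylinderEulerSolution.rotZ_velocity_eq`), so every extended slice is axisymmetric
(`isAxisymmetric_extendByData`), and the extension is still a solution of the periodic class
(`isPeriodicCylinderEulerSolution_extendByData`) (Kato–Lai 1984 Thm I, uniqueness clause;
Majda–Bertozzi §1.2 Prop. 1.1 (iii) and §2.3.3 for the whole-space version of the argument).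
[cite: KatoLai1984, Thm I (p. 17), uniqueness clause] -/
theorem IsPeriodicCylinderEulerSolution.isCylinderEulerSolution_extendByData
    (hU : KatoLai1984_periodicCylinderUniqueness) {L : ℝ} (hL : 0 < L) {T : ℝ} {u₀ : ℝ³ → ℝ³}
    {u : ℝ → ℝ³ → ℝ³} {p : ℝ → ℝ³ → ℝ} (h : IsPeriodicCylinderEulerSolution L (Ico 0 T) u₀ u p)
    (hax : IsAxisymmetric u₀) (hper : IsAxiallyPeriodic L u₀) :
    IsCylinderEulerSolution L (Ico 0 T) u₀ (extendByData u₀ u) p :=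
  (isPeriodicCylinderEulerSolution_extendByData h hper).isCylinderEulerSolution fun _ ht =>
    isAxisymmetric_extendByData hax fun θ _ hx => h.rotZ_velocity_eq hU hL hax θ ht hx

/-- **Local existence in the axisymmetric class from existence without symmetry and
uniqueness** (the step "the symmetries propagate by the uniqueness clause of Thm I", made a
theorem; Kato–Lai 1984, Thm I/II, p. 17). Hypothesis `hE`: every smooth velocity field on `ℝ³`,
`L`-periodic in `z` (`L > 0`), divergence free in `{r < 1}` and tangential on `{r = 1}`, launches
for some `T > 0` a solution of the periodic class `IsPeriodicCylinderEulerSolution L [0, T) u₀`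
(Thm I existence with Thm II, no symmetry — derived in `KatoLaiUniformExistenceBridge.lean` from
the named fact `KatoLai1984_periodicCylinderUniformExistence`). Conclusion: axisymmetric such data
launch a solution of the axisymmetric class `IsCylinderEulerSolution L [0, T) u₀` — the
local-existence hypothesis of `Ferrari1993_periodicCylinderEulerBKM_of_localExistence_of_continuation`.
Proof: `IsPeriodicCylinderEulerSolution.isCylinderEulerSolution_extendByData`. [cite: KatoLai1984, Thm I and Thm II (p. 17), with the uniqueness clause of Thm I] -/
theorem KatoLai1984_periodicCylinderLocalExistence_of_existence_of_uniqueness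
    (hE : ∀ (L : ℝ) (_hL : 0 < L) (u₀ : ℝ³ → ℝ³) (_hsmooth : ContDiff ℝ ∞ u₀)
      (_hper : IsAxiallyPeriodic L u₀)
      (_hdiv : ∀ x ∈ (unitCylinder : Set ℝ³), VectorCalculus.divergence u₀ x = 0)
      (_hslip : ∀ x ∈ frontier (unitCylinder : Set ℝ³), ⟪u₀ x, eR x⟫ = 0),
      ∃ T : ℝ, 0 < T ∧ ∃ (u : ℝ → ℝ³ → ℝ³) (p : ℝ → ℝ³ → ℝ),
        IsPeriodicCylinderEulerSolution L (Ico 0 T) u₀ u p)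
    (hU : KatoLai1984_periodicCylinderUniqueness) :
    ∀ (L : ℝ) (_hL : 0 < L) (u₀ : ℝ³ → ℝ³) (_hsmooth : ContDiff ℝ ∞ u₀)
      (_haxi : IsAxisymmetric u₀) (_hper : IsAxiallyPeriodic L u₀)
      (_hdiv : ∀ x ∈ (unitCylinder : Set ℝ³), VectorCalculus.divergence u₀ x = 0)
      (_hslip : ∀ x ∈ frontier (unitCylinder : Set ℝ³), ⟪u₀ x, eR x⟫ = 0),
      ∃ T : ℝ, 0 < T ∧ ∃ (u : ℝ → ℝ³ → ℝ³) (p : ℝ → ℝ³ → ℝ),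
        IsCylinderEulerSolution L (Ico 0 T) u₀ u p := by
  intro L hL u₀ hsm hax hper hdiv hslip
  obtain ⟨T, hT, u, p, hsol⟩ := hE L hL u₀ hsm hper hdiv hslip
  exact ⟨T, hT, extendByData u₀ u, p, hsol.isCylinderEulerSolution_extendByData hU hL hax hper⟩

end Literature.Analysis.FluidPDE
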